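import Mathlib
import HarnessLib
import Summits.ValiantsHypothesis.ValiantsHypothesis.Theorems.LacunarySymmetroidMatrixDescartesProductPlusOnePoleCloud
import Summits.ValiantsHypothesis.ValiantsHypothesis.Theorems.LacunarySymmetroidMatrixDescartesProductPlusOneSlopeMixedLine

/-!
# LINE (A) `product_plus_one` — the ρ_I = 1 riser cell with POLES ON BOTH SIDES (LINE currency, K = 3): one switched incoherent riser against a
# company of unswitched incoherent rows, already-switched coherent rows AND already-switched knee-less (binomial) incoherent rows

Crux item stmt-ValiantsHypothesis-18050, W-budget frame EB2-W.  Wrapper of ✓/⧗ `…ProductPlusOnePoleCloud` (`oneRiser_poleCloud_no_three_zeros`: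
a switched binomial incoherent row is a log-convex pull) in the format of ✓ `…SlopeMixedLine`.

* ★★ `oneRiser_poleCompany_wronskian_no_three_zeros` — support `d 1 = d 0 + e₁ + 1`, `d 2 = d 1 + e₂ + 1`; riser `j₀` (`a_{j₀0} ≥ 0`, `a_{j₀1} < 0`,
  `a_{j₀2} < 0`) switched on `[x₁, x₃] ⊂ (0,∞)`; every other row is EITHER an unswitched incoherent puller (`a_{j0} > 0`, `a_{j1}, a_{j2} ≤ 0`,
  `a_{j1} + a_{j2} < 0`, `f_j(x₃) > 0`) OR a coherent row already switched at `x₁` (`a_{j0} > 0`, `a_{j1} > 0 > a_{j2}`, `f_j(x₁) < 0`) OR a KNEE-LESS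
  incoherent row already switched at `x₁` (`a_{j0} > 0`, `a_{j1}, a_{j2} ≤ 0`, `a_{j1}·a_{j2} = 0`, `a_{j1} + a_{j2} < 0`, `f_j(x₁) < 0` — a pole of rate
  `p` or `q` to the LEFT of the window) ⇒ `W(∏_j f_j)` does not vanish at three points `x₁ < x₂ < x₃`;
* ★ `oneRiser_poleCompany_wronskian_roots_le_two` (window `(u,v)`: pullers unswitched at `v`, coherent / knee-less rows switched at `u`) and
  ★★ `oneRiser_poleCompany_eulerNumerator_roots_le_three` (every coupling `l₀`, `u ≤ v`).
So the first interaction cell holds on INNER windows `(t_i, t_{i+1})` of an incoherent company whenever every row switched before `t_i` other than the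
riser is knee-less: «one hump + poles anywhere, no slow bumps ⇒ one component» (W-CB) in LINE currency.  HONEST FRAMING: one cell; a second TRINOMIAL
switched row (two humps), one-signed rows, `WronskianBudgetK3` / `OneChangeFloorK3` / the stubs / 18050 / `MatrixDescartes` OPEN; `VP ≠ VNP` NOT proved.
No definitions, no named facts.
-/

set_option linter.dupNamespace false

namespace Summit.ValiantsHypothesis.ValiantsHypothesis.Theorems.LacunarySymmetroidMatrixDescartes

namespace ProductPlusOne

open Finset Polynomial
open scoped BigOperators Polynomial

/-- An incoherent normal form `A − Bx^p − Cx^q` (`B, C ≥ 0`) negative at `x₁ > 0` stays negative to the right. [folklore] -/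
theorem incoherent_value_neg_of_ge (e₁ e₂ : ℕ) (A B C : ℝ) (hB : 0 ≤ B) (hC : 0 ≤ C) {x₁ x : ℝ} (h0 : 0 < x₁) (hle : x₁ ≤ x)
    (h1 : A - B * x₁ ^ (e₁ + 1) - C * x₁ ^ (e₁ + e₂ + 2) < 0) : A - B * x ^ (e₁ + 1) - C * x ^ (e₁ + e₂ + 2) < 0 := by
  have hm1 : B * x₁ ^ (e₁ + 1) ≤ B * x ^ (e₁ + 1) := mul_le_mul_of_nonneg_left (pow_le_pow_left₀ h0.le hle _) hB
  have hm2 : C * x₁ ^ (e₁ + e₂ + 2) ≤ C * x ^ (e₁ + e₂ + 2) := mul_le_mul_of_nonneg_left (pow_le_pow_left₀ h0.le hle _) hC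
  linarith

/-- ★★ **ONE SWITCHED INCOHERENT RISER IN A POLE COMPANY (pullers, switched coherent rows, switched knee-less poles): the company's log-Wronskian has NO THREE ZEROS on the window** (LINE currency). [this file's theorem] -/
theorem oneRiser_poleCompany_wronskian_no_three_zeros {m : ℕ} (d : Fin 3 → ℕ) (e₁ e₂ : ℕ)
    (he₁ : d 1 = d 0 + e₁ + 1) (he₂ : d 2 = d 1 + e₂ + 1)
    (a : Fin m → Fin 3 → ℝ) (j₀ : Fin m) (hr0 : 0 ≤ a j₀ 0) (hr1 : a j₀ 1 < 0) (hr2 : a j₀ 2 < 0)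
    {x₁ x₂ x₃ : ℝ} (h0 : 0 < x₁) (h12' : x₁ < x₂) (h23 : x₂ < x₃)
    (hcls : ∀ j, j ≠ j₀ →
      (0 < a j 0 ∧ a j 1 ≤ 0 ∧ a j 2 ≤ 0 ∧ a j 1 + a j 2 < 0 ∧ 0 < (∑ l, C (a j l) * X ^ (d l) : ℝ[X]).eval x₃) ∨
      (0 < a j 0 ∧ 0 < a j 1 ∧ a j 2 < 0 ∧ (∑ l, C (a j l) * X ^ (d l) : ℝ[X]).eval x₁ < 0) ∨
      (0 < a j 0 ∧ a j 1 ≤ 0 ∧ a j 2 ≤ 0 ∧ a j 1 * a j 2 = 0 ∧ a j 1 + a j 2 < 0 ∧ (∑ l, C (a j l) * X ^ (d l) : ℝ[X]).eval x₁ < 0))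
    (hsw : ∀ x ∈ Set.Icc x₁ x₃, (∑ l, C (a j₀ l) * X ^ (d l) : ℝ[X]).eval x < 0)
    (hzero : ∀ x ∈ ({x₁, x₂, x₃} : Set ℝ),
      ((∏ j, ∑ l, C (a j l) * X ^ (d l) : ℝ[X]) * (X * derivative (X * derivative (∏ j, ∑ l, C (a j l) * X ^ (d l) : ℝ[X])))
        - (X * derivative (∏ j, ∑ l, C (a j l) * X ^ (d l) : ℝ[X])) ^ 2).eval x = 0) : False := by
  classical
  have hd := fin3_support_eq_gaps d e₁ e₂ he₁ he₂
  have hev : ∀ j x, (∑ l, C (a j l) * X ^ (d l) : ℝ[X]).eval x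
        = x ^ (d 0) * (a j 0 - (-(a j 1)) * x ^ (e₁ + 1) - (-(a j 2)) * x ^ (e₁ + e₂ + 2)) := by
    intro j x
    have h := (eval_trinomial_three (d 0) (e₁ + 1) (e₁ + e₂ + 2) (a j) x).1
    rw [hd] at h; rw [h]; ring
  have h13 : x₁ < x₃ := h12'.trans h23
  have hIcc : ∀ x ∈ ({x₁, x₂, x₃} : Set ℝ), x ∈ Set.Icc x₁ x₃ := by
    intro x hx
    simp only [Set.mem_insert_iff, Set.mem_singleton_iff] at hx
    rcases hx with h | h | h <;> (subst h; constructor <;> linarith)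
  have hx3 : 0 < x₃ := h0.trans h13
  -- riser in normal form
  have hsw' : ∀ x ∈ Set.Icc x₁ x₃, a j₀ 0 - (-(a j₀ 1)) * x ^ (e₁ + 1) - (-(a j₀ 2)) * x ^ (e₁ + e₂ + 2) < 0 := by
    intro x hx
    have h := hsw x hx
    rw [hev] at h
    exact ((mul_neg_iff.1 h).resolve_right (fun h' => absurd (pow_pos (h0.trans_le hx.1) _) (not_lt.2 h'.1.le))).2
  -- the other rows, pointwise on the window, in mixed-cloud form
  have hrow : ∀ x ∈ Set.Icc x₁ x₃, ∀ j ∈ Finset.univ.erase j₀,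
      (0 ≤ -(a j 1) ∧ 0 ≤ -(a j 2) ∧ 0 < -(a j 1) + -(a j 2) ∧ 0 < a j 0 - (-(a j 1)) * x ^ (e₁ + 1) - (-(a j 2)) * x ^ (e₁ + e₂ + 2))
      ∨ (0 < a j 0 ∧ -(a j 1) < 0 ∧ 0 < -(a j 2) ∧ a j 0 - (-(a j 1)) * x ^ (e₁ + 1) - (-(a j 2)) * x ^ (e₁ + e₂ + 2) < 0)
      ∨ (0 < a j 0 ∧ 0 ≤ -(a j 1) ∧ 0 ≤ -(a j 2) ∧ -(a j 1) * -(a j 2) = 0 ∧ 0 < -(a j 1) + -(a j 2)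
          ∧ a j 0 - (-(a j 1)) * x ^ (e₁ + 1) - (-(a j 2)) * x ^ (e₁ + e₂ + 2) < 0) := by
    intro x hx j hj
    have hj' := Finset.ne_of_mem_erase hj
    have hx0 : 0 < x := h0.trans_le hx.1
    rcases hcls j hj' with ⟨_, h1, h2, h12, hun⟩ | ⟨hA, h1, h2, hsw1⟩ | ⟨hA, h1, h2, h12, hs, hsw1⟩
    · left
      rw [hev] at hun
      have h3 : 0 < a j 0 - (-(a j 1)) * x₃ ^ (e₁ + 1) - (-(a j 2)) * x₃ ^ (e₁ + e₂ + 2) :=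
        (mul_pos_iff_of_pos_left (pow_pos hx3 _)).1 hun
      have hm1 : a j 1 * x₃ ^ (e₁ + 1) ≤ a j 1 * x ^ (e₁ + 1) := mul_le_mul_of_nonpos_left (pow_le_pow_left₀ hx0.le hx.2 _) h1
      have hm2 : a j 2 * x₃ ^ (e₁ + e₂ + 2) ≤ a j 2 * x ^ (e₁ + e₂ + 2) := mul_le_mul_of_nonpos_left (pow_le_pow_left₀ hx0.le hx.2 _) h2
      exact ⟨by linarith, by linarith, by linarith, by linarith⟩
    · right; left
      rw [hev] at hsw1
      have h1' : a j 0 - (-(a j 1)) * x₁ ^ (e₁ + 1) - (-(a j 2)) * x₁ ^ (e₁ + e₂ + 2) < 0 :=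
        ((mul_neg_iff.1 hsw1).resolve_right (fun h' => absurd (pow_pos h0 _) (not_lt.2 h'.1.le))).2
      exact ⟨hA, by linarith, by linarith, coherent_value_neg_of_ge e₁ e₂ (a j 0) (-(a j 1)) (-(a j 2)) hA.le (by linarith) h0 hx.1 h1'⟩
    · right; right
      rw [hev] at hsw1
      have h1' : a j 0 - (-(a j 1)) * x₁ ^ (e₁ + 1) - (-(a j 2)) * x₁ ^ (e₁ + e₂ + 2) < 0 :=
        ((mul_neg_iff.1 hsw1).resolve_right (fun h' => absurd (pow_pos h0 _) (not_lt.2 h'.1.le))).2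
      exact ⟨hA, by linarith, by linarith, by rw [neg_mul_neg]; exact h12, by linarith,
        incoherent_value_neg_of_ge e₁ e₂ (a j 0) (-(a j 1)) (-(a j 2)) (by linarith) (by linarith) h0 hx.1 h1'⟩
  -- no row vanishes on the window
  have hf : ∀ x ∈ Set.Icc x₁ x₃, ∀ j, (∑ l, C (a j l) * X ^ (d l) : ℝ[X]).eval x ≠ 0 := by
    intro x hx j
    have hx0 : 0 < x := h0.trans_le hx.1
    rw [hev]
    refine mul_ne_zero (pow_ne_zero _ hx0.ne') ?_
    by_cases hj : j = j₀
    · subst hj; exact (hsw' x hx).ne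
    · rcases hrow x hx j (Finset.mem_erase.2 ⟨hj, Finset.mem_univ _⟩) with ⟨_, _, _, h⟩ | ⟨_, _, _, h⟩ | ⟨_, _, _, _, _, h⟩
      · exact h.ne'
      · exact h.ne
      · exact h.ne
  -- the slope-form sum vanishes at the three points
  have hzero' : ∀ x ∈ ({x₁, x₂, x₃} : Set ℝ),
      rowPsi1 e₁ e₂ (a j₀ 0) (-(a j₀ 1)) (-(a j₀ 2)) x
        + cloudP1 e₁ e₂ (Finset.univ.erase j₀) (fun _ => (1 : ℝ)) (fun j => a j 0) (fun j => -(a j 1)) (fun j => -(a j 2)) x = 0 := by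
    intro x hx
    have hxI := hIcc x hx
    have hx0 : 0 < x := h0.trans_le hxI.1
    have h := hzero x hx
    rw [logWronskian_prod_eq_rowPsi1_sum d e₁ e₂ he₁ he₂ a hx0 (hf x hxI)] at h
    have hP : ((∏ j, (∑ l, C (a j l) * X ^ (d l) : ℝ[X])).eval x) ≠ 0 := by
      rw [eval_prod]; exact Finset.prod_ne_zero_iff.2 fun j _ => hf x hxI j
    have hS : ∑ j, rowPsi1 e₁ e₂ (a j 0) (-(a j 1)) (-(a j 2)) x = 0 := by
      rcases mul_eq_zero.1 h with h1 | h1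
      · exact absurd (neg_eq_zero.1 h1) (pow_ne_zero 2 hP)
      · exact h1
    rw [← Finset.add_sum_erase _ _ (Finset.mem_univ j₀)] at hS
    unfold cloudP1
    simpa only [one_mul] using hS
  rcases (Finset.univ.erase j₀).eq_empty_or_nonempty with hs | hs
  · have h1 := hzero' x₁ (by simp)
    have h2 := hzero' x₂ (by simp)
    rw [hs] at h1 h2
    simp only [cloudP1, Finset.sum_empty, add_zero] at h1 h2
    have hper := riser_turning_persist e₁ e₂ (a j₀ 0) (-(a j₀ 1)) (-(a j₀ 2)) (by linarith) (by linarith) h0 h13.le hsw'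
      h1.le x₂ ⟨h12', h23.le⟩
    exact absurd h2 hper.ne
  · exact oneRiser_poleCloud_no_three_zeros e₁ e₂ (a := a j₀ 0) (b := -(a j₀ 1)) (c := -(a j₀ 2)) hr0 (by linarith) (by linarith)
      (Finset.univ.erase j₀) hs (fun _ => (1 : ℝ)) (fun j => a j 0) (fun j => -(a j 1)) (fun j => -(a j 2))
      (fun _ _ => one_pos) h0 h12' h23 hsw' hrow hzero'

/-- ★ **≤ 2 zeros of the company's log-Wronskian on the window** (riser switched on `[u,v]`, pullers unswitched at `v`, coherent and knee-less rows switched at `u`). -/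
theorem oneRiser_poleCompany_wronskian_roots_le_two {m : ℕ} (d : Fin 3 → ℕ) (e₁ e₂ : ℕ)
    (he₁ : d 1 = d 0 + e₁ + 1) (he₂ : d 2 = d 1 + e₂ + 1)
    (a : Fin m → Fin 3 → ℝ) (j₀ : Fin m) (hr0 : 0 ≤ a j₀ 0) (hr1 : a j₀ 1 < 0) (hr2 : a j₀ 2 < 0)
    {u v : ℝ} (hu : 0 < u)
    (hcls : ∀ j, j ≠ j₀ →
      (0 < a j 0 ∧ a j 1 ≤ 0 ∧ a j 2 ≤ 0 ∧ a j 1 + a j 2 < 0 ∧ 0 < (∑ l, C (a j l) * X ^ (d l) : ℝ[X]).eval v) ∨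
      (0 < a j 0 ∧ 0 < a j 1 ∧ a j 2 < 0 ∧ (∑ l, C (a j l) * X ^ (d l) : ℝ[X]).eval u < 0) ∨
      (0 < a j 0 ∧ a j 1 ≤ 0 ∧ a j 2 ≤ 0 ∧ a j 1 * a j 2 = 0 ∧ a j 1 + a j 2 < 0 ∧ (∑ l, C (a j l) * X ^ (d l) : ℝ[X]).eval u < 0))
    (hsw : ∀ x ∈ Set.Icc u v, (∑ l, C (a j₀ l) * X ^ (d l) : ℝ[X]).eval x < 0) :
    (((∏ j, ∑ l, C (a j l) * X ^ (d l) : ℝ[X]) * (X * derivative (X * derivative (∏ j, ∑ l, C (a j l) * X ^ (d l) : ℝ[X])))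
        - (X * derivative (∏ j, ∑ l, C (a j l) * X ^ (d l) : ℝ[X])) ^ 2).roots.toFinset.filter (fun w => u < w ∧ w < v)).card ≤ 2 := by
  classical
  set W : ℝ[X] := (∏ j, ∑ l, C (a j l) * X ^ (d l) : ℝ[X]) * (X * derivative (X * derivative (∏ j, ∑ l, C (a j l) * X ^ (d l) : ℝ[X])))
      - (X * derivative (∏ j, ∑ l, C (a j l) * X ^ (d l) : ℝ[X])) ^ 2 with hWdef
  by_contra hgt
  push Not at hgt
  obtain ⟨y₁, hy₁, y₂, hy₂, y₃, hy₃, h12', h23⟩ := exists_three_lt_of_card (T := W.roots.toFinset.filter (fun w => u < w ∧ w < v)) hgt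
  by_cases hW0 : W = 0
  · rw [hW0, roots_zero, Multiset.toFinset_zero, Finset.filter_empty] at hy₁; exact absurd hy₁ (Finset.notMem_empty _)
  rw [mem_filter, Multiset.mem_toFinset, mem_roots hW0] at hy₁ hy₂ hy₃
  have hd := fin3_support_eq_gaps d e₁ e₂ he₁ he₂
  have hev : ∀ j x, (∑ l, C (a j l) * X ^ (d l) : ℝ[X]).eval x
        = x ^ (d 0) * (a j 0 - (-(a j 1)) * x ^ (e₁ + 1) - (-(a j 2)) * x ^ (e₁ + e₂ + 2)) := by
    intro j x
    have h := (eval_trinomial_three (d 0) (e₁ + 1) (e₁ + e₂ + 2) (a j) x).1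
    rw [hd] at h; rw [h]; ring
  have hv0 : 0 < v := hu.trans (hy₁.2.1.trans hy₁.2.2)
  have hy10 : 0 < y₁ := hu.trans hy₁.2.1
  have hy30 : 0 < y₃ := hu.trans hy₃.2.1
  -- transport the class hypotheses from `(u, v)` to `(y₁, y₃)`
  have hcls' : ∀ j, j ≠ j₀ →
      (0 < a j 0 ∧ a j 1 ≤ 0 ∧ a j 2 ≤ 0 ∧ a j 1 + a j 2 < 0 ∧ 0 < (∑ l, C (a j l) * X ^ (d l) : ℝ[X]).eval y₃) ∨
      (0 < a j 0 ∧ 0 < a j 1 ∧ a j 2 < 0 ∧ (∑ l, C (a j l) * X ^ (d l) : ℝ[X]).eval y₁ < 0) ∨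
      (0 < a j 0 ∧ a j 1 ≤ 0 ∧ a j 2 ≤ 0 ∧ a j 1 * a j 2 = 0 ∧ a j 1 + a j 2 < 0 ∧ (∑ l, C (a j l) * X ^ (d l) : ℝ[X]).eval y₁ < 0) := by
    intro j hj
    rcases hcls j hj with ⟨hA, h1, h2, h12, hun⟩ | ⟨hA, h1, h2, hsw1⟩ | ⟨hA, h1, h2, h12, hs, hsw1⟩
    · left
      refine ⟨hA, h1, h2, h12, ?_⟩
      rw [hev] at hun ⊢
      have h3 : 0 < a j 0 - (-(a j 1)) * v ^ (e₁ + 1) - (-(a j 2)) * v ^ (e₁ + e₂ + 2) := (mul_pos_iff_of_pos_left (pow_pos hv0 _)).1 hun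
      have hm1 : a j 1 * v ^ (e₁ + 1) ≤ a j 1 * y₃ ^ (e₁ + 1) := mul_le_mul_of_nonpos_left (pow_le_pow_left₀ hy30.le hy₃.2.2.le _) h1
      have hm2 : a j 2 * v ^ (e₁ + e₂ + 2) ≤ a j 2 * y₃ ^ (e₁ + e₂ + 2) := mul_le_mul_of_nonpos_left (pow_le_pow_left₀ hy30.le hy₃.2.2.le _) h2
      exact mul_pos (pow_pos hy30 _) (by linarith)
    · right; left
      refine ⟨hA, h1, h2, ?_⟩
      rw [hev] at hsw1 ⊢
      have h1' : a j 0 - (-(a j 1)) * u ^ (e₁ + 1) - (-(a j 2)) * u ^ (e₁ + e₂ + 2) < 0 :=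
        ((mul_neg_iff.1 hsw1).resolve_right (fun h' => absurd (pow_pos hu _) (not_lt.2 h'.1.le))).2
      exact mul_neg_of_pos_of_neg (pow_pos hy10 _)
        (coherent_value_neg_of_ge e₁ e₂ (a j 0) (-(a j 1)) (-(a j 2)) hA.le (by linarith) hu hy₁.2.1.le h1')
    · right; right
      refine ⟨hA, h1, h2, h12, hs, ?_⟩
      rw [hev] at hsw1 ⊢
      have h1' : a j 0 - (-(a j 1)) * u ^ (e₁ + 1) - (-(a j 2)) * u ^ (e₁ + e₂ + 2) < 0 :=
        ((mul_neg_iff.1 hsw1).resolve_right (fun h' => absurd (pow_pos hu _) (not_lt.2 h'.1.le))).2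
      exact mul_neg_of_pos_of_neg (pow_pos hy10 _)
        (incoherent_value_neg_of_ge e₁ e₂ (a j 0) (-(a j 1)) (-(a j 2)) (by linarith) (by linarith) hu hy₁.2.1.le h1')
  refine oneRiser_poleCompany_wronskian_no_three_zeros d e₁ e₂ he₁ he₂ a j₀ hr0 hr1 hr2 hy10 h12' h23 hcls'
    (fun x hx => hsw x ⟨hy₁.2.1.le.trans hx.1, hx.2.trans hy₃.2.2.le⟩) ?_
  intro x hx
  simp only [Set.mem_insert_iff, Set.mem_singleton_iff] at hx
  rcases hx with h | h | h <;> subst h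
  · exact hy₁.1
  · exact hy₂.1
  · exact hy₃.1

/-- ★★ **Hence AT MOST THREE zeros of `eulerNumerator d a l₀` on the window, for EVERY coupling `l₀`.** [this file's theorem] -/
theorem oneRiser_poleCompany_eulerNumerator_roots_le_three {m : ℕ} (d : Fin 3 → ℕ) (e₁ e₂ : ℕ)
    (he₁ : d 1 = d 0 + e₁ + 1) (he₂ : d 2 = d 1 + e₂ + 1)
    (a : Fin m → Fin 3 → ℝ) (j₀ : Fin m) (hr0 : 0 ≤ a j₀ 0) (hr1 : a j₀ 1 < 0) (hr2 : a j₀ 2 < 0)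
    (l₀ : Fin 3) {u v : ℝ} (hu : 0 < u) (huv : u ≤ v)
    (hcls : ∀ j, j ≠ j₀ →
      (0 < a j 0 ∧ a j 1 ≤ 0 ∧ a j 2 ≤ 0 ∧ a j 1 + a j 2 < 0 ∧ 0 < (∑ l, C (a j l) * X ^ (d l) : ℝ[X]).eval v) ∨
      (0 < a j 0 ∧ 0 < a j 1 ∧ a j 2 < 0 ∧ (∑ l, C (a j l) * X ^ (d l) : ℝ[X]).eval u < 0) ∨
      (0 < a j 0 ∧ a j 1 ≤ 0 ∧ a j 2 ≤ 0 ∧ a j 1 * a j 2 = 0 ∧ a j 1 + a j 2 < 0 ∧ (∑ l, C (a j l) * X ^ (d l) : ℝ[X]).eval u < 0))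
    (hsw : ∀ x ∈ Set.Icc u v, (∑ l, C (a j₀ l) * X ^ (d l) : ℝ[X]).eval x < 0) :
    ((∑ j, (∑ l, C (a j l * ((d l : ℝ) - d l₀)) * X ^ (d l)) * ∏ i ∈ Finset.univ.erase j, (∑ l, C (a i l) * X ^ (d l))
        : ℝ[X]).roots.toFinset.filter (fun t => u ≤ t ∧ t ≤ v)).card ≤ 3 := by
  classical
  have hd := fin3_support_eq_gaps d e₁ e₂ he₁ he₂
  have hev : ∀ j x, (∑ l, C (a j l) * X ^ (d l) : ℝ[X]).eval x
        = x ^ (d 0) * (a j 0 - (-(a j 1)) * x ^ (e₁ + 1) - (-(a j 2)) * x ^ (e₁ + e₂ + 2)) := by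
    intro j x
    have h := (eval_trinomial_three (d 0) (e₁ + 1) (e₁ + e₂ + 2) (a j) x).1
    rw [hd] at h; rw [h]; ring
  have hv0 : 0 < v := hu.trans_le huv
  have hP : ∀ t ∈ Set.Icc u v, (∏ j, (∑ l, C (a j l) * X ^ (d l) : ℝ[X])).eval t ≠ 0 := by
    intro t ht
    have ht0 : 0 < t := hu.trans_le ht.1
    rw [eval_prod]
    refine Finset.prod_ne_zero_iff.2 fun j _ => ?_
    by_cases hj : j = j₀
    · subst hj; exact (hsw t ht).ne
    rw [hev]
    refine mul_ne_zero (pow_ne_zero _ ht0.ne') ?_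
    rcases hcls j hj with ⟨_, h1, h2, _, hun⟩ | ⟨hA, h1, _, hsw1⟩ | ⟨_, h1, h2, _, _, hsw1⟩
    · rw [hev] at hun
      have h3 : 0 < a j 0 - (-(a j 1)) * v ^ (e₁ + 1) - (-(a j 2)) * v ^ (e₁ + e₂ + 2) := (mul_pos_iff_of_pos_left (pow_pos hv0 _)).1 hun
      have hm1 : a j 1 * v ^ (e₁ + 1) ≤ a j 1 * t ^ (e₁ + 1) := mul_le_mul_of_nonpos_left (pow_le_pow_left₀ ht0.le ht.2 _) h1
      have hm2 : a j 2 * v ^ (e₁ + e₂ + 2) ≤ a j 2 * t ^ (e₁ + e₂ + 2) := mul_le_mul_of_nonpos_left (pow_le_pow_left₀ ht0.le ht.2 _) h2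
      exact ne_of_gt (by linarith)
    · rw [hev] at hsw1
      have h1' : a j 0 - (-(a j 1)) * u ^ (e₁ + 1) - (-(a j 2)) * u ^ (e₁ + e₂ + 2) < 0 :=
        ((mul_neg_iff.1 hsw1).resolve_right (fun h' => absurd (pow_pos hu _) (not_lt.2 h'.1.le))).2
      exact (coherent_value_neg_of_ge e₁ e₂ (a j 0) (-(a j 1)) (-(a j 2)) hA.le (by linarith) hu ht.1 h1').ne
    · rw [hev] at hsw1
      have h1' : a j 0 - (-(a j 1)) * u ^ (e₁ + 1) - (-(a j 2)) * u ^ (e₁ + e₂ + 2) < 0 :=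
        ((mul_neg_iff.1 hsw1).resolve_right (fun h' => absurd (pow_pos hu _) (not_lt.2 h'.1.le))).2
      exact (incoherent_value_neg_of_ge e₁ e₂ (a j 0) (-(a j 1)) (-(a j 2)) (by linarith) (by linarith) hu ht.1 h1').ne
  have h1 := eulerNumerator_roots_Icc_le_wronskian_roots_add_one d a l₀ hu hP
  have h2 := oneRiser_poleCompany_wronskian_roots_le_two d e₁ e₂ he₁ he₂ a j₀ hr0 hr1 hr2 hu hcls hsw
  omega

end ProductPlusOne

end Summit.ValiantsHypothesis.ValiantsHypothesis.Theorems.LacunarySymmetroidMatrixDescartes
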